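import Mathlib
import HarnessLib
import Summits.HubbardSuperconductivity.HubbardSuperconductivity.Theorems.KLProgrammeKLRegimeEngineTowerBlockStepWtFull
import Summits.HubbardSuperconductivity.HubbardSuperconductivity.Theorems.KLProgrammeKLRegimeEngineTowerBlockIncrWt
import Summits.HubbardSuperconductivity.HubbardSuperconductivity.Theorems.KLProgrammeKLRegimeEngineTowerModelDefsWtFull

/-!
# Route `KLProgramme` — crux K3 ENGINE (stmt-HubbardSuperconductivity-20437 `KLRegimeEngineV17F2`), stub (b) v2, THE LEVELS PACKAGE (ℓ):
# instantiation (I1), MODEL HALF, WEIGHTED ALL-KNOWN TRACK, APPLIED TO THE TOWER'S OWN INCREMENTS — the single-tuple weighted pinned sums of `Δ_k` and the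
# law-side row of the carrier `klTowerBornWtFull`
# (E1-LEVELS-BLUEPRINT-g8 (I1); located item «(I2)-WT-ONCLASS», cure (α′), plan g22 (R165)/(R167); cell gate-hubbard-kl, seat hubbard-kl-k3c2-p3 g12 as
#  SUBSTITUTE typer while the E1 lineage is unseated — E1 may rename / supersede)

`…EngineTowerBlockStepWtFull` bounds, for ANY even input `G` without constant part, the two pieces of a block step in the weighted currency with PRESCRIBED
output legs.  Here (exactly as in E1's `…EngineTowerBlockIncrWt` for the one-pinned-leg weighted track) `G` is the tower's own block input
`klTowerInput … d k = 𝒱_{dk}[K]`, the output is the block increment `klTowerIncr … d k = Δ_k` read at `F_{J′}`, `J′ ≥ dk`, with weight `klScaleWt L M β J′` and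
leg maps `latticeLegPos (2·(2M))`, and ALL output legs but the pinned one are prescribed — the currency of the weighted all-known born array `klTowerBornWtFull`
(`…EngineTowerModelDefsWtFull`, p624466):

* §1 `sum_filter_prescribedAll_eq_pinnedTuple` — the door's output sum with every other leg prescribed (`J = univ.erase i`, pin `w″ = (y, σ′ i)`) IS the
  single-tuple weighted pinned sum `Σ_{x′ : x′ i = y} klScaleWt(pos x′)·‖W^{F_J}_{σ′}(T)(x′)‖` of the carrier (`kernel_map_sectorAnalysis`, a relabelling);
  `sum_landingProfiles_eq_of_equiv` — the graded-prescribed bracket's average over landing profiles `pf : J → Fin n` depends on `J` only through `|J|`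
  (reindexing along `Fin |J| ≃ J`);
* §2 **`pinnedTupleWtSum_klTowerIncr_le`** — for `1 ≤ d`, `1 ≤ k`, `dk ≤ J′`, `Z^K_{Λ_{dk}} ≠ 0` and the block constants of …BlockStepWtFull: in every even
  degree `2(q+1)`, for every pinned leg `i`, full label tuple `σ′` and pin `y`,
  `ε^{2q+1}·Σ_{x′ : x′ i = y} klScaleWt_{J′}(pos x′)·‖W^{F_{J′}}_{σ′}(Δ_k)(x′)‖ ≤ ε^{2q+1}·(graded-prescribed RHS at m = 2q+1 + binomial-prescribed RHS at q)`
  (`J = univ.erase i`) in the WEIGHTED PRESCRIBED input sizes `B m′ Fc` of `𝒱_{dk}` at `F_{dk−1}`;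
* §3 **`klTowerBornWtFull_le_of_blockConsts`** — at `J′ = dk` the supremum over `(i, σ′, y)`: `klTowerBornWtFull … d k (2(q+1)) ≤ ε^{2q+1}·(…)` with the
  right side made pin-free (landing profiles over `Fin (2q+1)`, first-order falling factor `(2m′ − i) ≤ 2m′`).
The door→kit majorisation of the prescribed bracket and the division by the output unit are the kit dictionary's ((I1-dim), E1 / k3c3-p2 g13's
`…TowerBlockIncrWtKit(Carrier)` pattern) and are NOT done here.  Compositions of landed theorems; nothing about the model is asserted beyond them; nothing asserts
(ℓ), any stub, K3 or superconductivity.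
References: BGM 2006 §2.7 (2.70)–(2.71a), §2.8 (2.76)–(2.84), (2.88)–(2.90), App. A3 [cite: BenfattoGiulianiMastropietro2006].
-/

noncomputable section

namespace Summit.HubbardSuperconductivity.HubbardSuperconductivity.Theorems.EngineV8

set_option linter.dupNamespace false -- summit = problem name (single-conjunct summit), D-0017

open Classical
open Real Finset Literature.MathematicalPhysics.QuantumLattice Literature.Probability.LatticeModels GrassmannAlgebra
open Summit.HubbardSuperconductivity.HubbardSuperconductivity.Theorems.KLProgrammeLegKernels
open Summit.HubbardSuperconductivity.HubbardSuperconductivity.Theorems.KLRegimeSplit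
open Summit.HubbardSuperconductivity.HubbardSuperconductivity.Theorems.KLRegimeWick
open Summit.HubbardSuperconductivity.HubbardSuperconductivity.Theorems.TwoPointAssembly
open Literature.Probability.LatticeModels.BattleFederbush

/-! ## §1 Relabelling rows -/

section Reindex

variable {L M : ℕ} [NeZero L]

/-- **The door's output sum with ALL other legs prescribed is the carrier's single-tuple weighted pinned sum.**  For a pinned leg `i`, a full label tuple
`σ′` and a pin `y`, the sum over the output tuples `X″` with `X″ i = (y, σ′ i)` and `(X″ j).2 = σ′ j` for `j ≠ i` of
`klScaleWt_{jr}(latticeLegPos ∘ X″)·‖kernel (map E(F_J)) T (m+1) X″‖` equals `Σ_{x′ : x′ i = y} klScaleWt_{jr}(pos x′)·‖W^{F_J}_{σ′}(T)(x′)‖`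
(`kernel_map_sectorAnalysis`; the relabelling `X″ = (x′, σ′)`). -/
theorem sum_filter_prescribedAll_eq_pinnedTuple (β μ : ℝ) (K : TrigPolyC4v) (J jr m : ℕ) (T : HubbardGrassmann L M)
    (i : Fin (m + 1)) (σ' : Fin (m + 1) → SectorLeg (sectorCount J)) (y : SpaceTimeIdx L M) :
    ∑ X'' ∈ univ.filter (fun X'' : Fin (m + 1) → SpaceTimeIdx L M × SectorLeg (sectorCount J) =>
        X'' i = (y, σ' i) ∧ ∀ j ∈ univ.erase i, (X'' j).2 = σ' j),
        klScaleWt L M β jr ((univ.image X'').image (latticeLegPos (2 * (2 * M)))) *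
          ‖kernel ℂ (ExteriorAlgebra.map (Matrix.toLin' (sectorAnalysisMatrix L M β (klAnisoFamily L M β μ K klE0 J))) T) (m + 1) X''‖ =
      ∑ x' ∈ univ.filter (fun x' : Fin (m + 1) → SpaceTimeIdx L M => x' i = y),
        klScaleWt L M β jr ((univ.image x').image (fun x : SpaceTimeIdx L M => (((((2 * (x.1 : ℕ) : ℕ)) : ZMod (2 * (2 * M)))), x.2))) *
          ‖sectorisedKernel L M β (klAnisoFamily L M β μ K klE0 J) T (m + 1) σ' x'‖ := by
  symm
  refine Finset.sum_nbij' (fun x' k => (x' k, σ' k)) (fun X'' k => (X'' k).1) ?_ ?_ ?_ ?_ ?_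
  · intro x' hx'
    have hx : x' i = y := (mem_filter.1 hx').2
    exact mem_filter.2 ⟨mem_univ _, Prod.ext hx rfl, fun j _ => rfl⟩
  · intro X'' hX''
    simp only [mem_filter, mem_univ, true_and] at hX'' ⊢
    rw [hX''.1]
  · intro x' _
    rfl
  · intro X'' hX''
    simp only [mem_filter, mem_univ, true_and] at hX''
    funext k
    by_cases hk : k = i
    · subst hk
      dsimp only
      rw [hX''.1]
    · exact Prod.ext rfl (hX''.2 k (mem_erase.2 ⟨hk, mem_univ _⟩)).symm
  · intro x' _
    rw [kernel_map_sectorAnalysis, image_latticeLegPos_eq_image_pos]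

omit [NeZero L] in
/-- **The landing-profile average depends on the prescribed leg set only through its cardinality**: reindexing the profiles `pf : α → Fin n` along an
equivalence `e : γ ≃ α` (products of per-leg factors and the per-vertex landing counts are transported). [folklore] -/
theorem sum_landingProfiles_eq_of_equiv {α γ : Type*} [Fintype α] [DecidableEq α] [Fintype γ] [DecidableEq γ] (e : γ ≃ α) {n : ℕ}
    (u : Fin n → ℝ) (D : ℝ) (v : Fin n → ℕ → ℝ) :
    ∑ pf : α → Fin n, (∏ j, u (pf j)) / D ^ Fintype.card α * ∏ a, v a (univ.filter fun j => pf j = a).card =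
      ∑ pf : γ → Fin n, (∏ j, u (pf j)) / D ^ Fintype.card γ * ∏ a, v a (univ.filter fun j => pf j = a).card := by
  refine Fintype.sum_equiv (Equiv.arrowCongr e.symm (Equiv.refl (Fin n))) _ _ fun pf => ?_
  have hcomp : ∀ j : γ, (Equiv.arrowCongr e.symm (Equiv.refl (Fin n))) pf j = pf (e j) := fun j => by
    simp [Equiv.arrowCongr_apply]
  rw [Fintype.card_congr e]
  congr 1
  · rw [← Fintype.prod_equiv e (fun j => u ((Equiv.arrowCongr e.symm (Equiv.refl (Fin n))) pf j)) (fun j => u (pf j))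
      (fun j => by rw [hcomp])]
  · refine prod_congr rfl fun a _ => ?_
    congr 1
    refine (Finset.card_equiv e fun j => ?_).symm
    simp only [mem_filter, mem_univ, true_and, hcomp]

end Reindex

/-! ## §2 The single-tuple weighted pinned sums of `Δ_k` -/

section Born

variable {L M : ℕ} [NeZero L] [NeZero M]

/-- **THE WEIGHTED ALL-KNOWN SIZES OF A BLOCK INCREMENT** (blueprint (I1), weighted all-known track, model half).  `1 ≤ d`, `1 ≤ k`, `dk ≤ J′`, `Z^K_{Λ_{dk}} ≠ 0`;
block constants of …BlockStepWtFull for the tower's weight `klScaleWt L M β J′` and leg maps `latticeLegPos (2·(2M))` (Gram `κ`, weighted `α`, weighted `(cr, cc)`,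
`ρ`, `θ < 1`); WEIGHTED PRESCRIBED input sizes `B m′ Fc` of `𝒱_{dk}` at `F_{dk−1}`.  Then in every even degree `2(q+1)`, for every pinned leg `i`, full label
tuple `σ′` and pin `y`:
`ε^{2q+1}·Σ_{x′ : x′ i = y} klScaleWt_{J′}(pos x′)·‖W^{F_{J′}}_{σ′}(Δ_k)(x′)‖ ≤ ε^{2q+1}·(graded-prescribed RHS + binomial-prescribed RHS)` with `J = univ.erase i`,
`τ″ = σ′`, parents constant `27`. -/
theorem pinnedTupleWtSum_klTowerIncr_le {β : ℝ} (hβ : 0 < β) (U μ : ℝ) (K : TrigPolyC4v) {d k J' : ℕ} (hd : 1 ≤ d) (hk : 1 ≤ k) (hJ' : d * k ≤ J')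
    (hZ : hubbardEffPartitionFnCT L M β U μ 0 K (klScale klE0 (d * k)) ≠ 0)
    {κ : ℝ} (hκ : 0 < κ)
    (hGB : IsGramBoundedR ((sectorSubMatrix L M β (bgmFatMultiplier L M klE0 β (nambuXiCT L μ K) (d * k - 1))).transpose *
      hubbardCovSliceCT L M β μ 0 K (klScale klE0 (d * (k + 1))) (klScale klE0 (d * k)) *
        sectorSubMatrix L M β (bgmFatMultiplier L M klE0 β (nambuXiCT L μ K) (d * k - 1))) κ)
    (B : ℕ → ℕ → ℝ) (hB0 : ∀ m' Fc, 0 ≤ B m' Fc)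
    (hB : ∀ (m' Fc : ℕ) (E : Finset (Fin (2 * m' + 1 + 1))) (τ : Fin (2 * m' + 1 + 1) → SectorLeg (sectorCount (d * k - 1)))
      (q : Fin (2 * m' + 1 + 1)), q ∈ E → E.card = Fc + 1 → ∀ y : SpaceTimeIdx L M,
        imagTimeWeight β M ^ (2 * m' + 1) *
          ∑ σ ∈ univ.filter (fun σ : Fin (2 * m' + 1 + 1) → SectorLeg (sectorCount (d * k - 1)) => ∀ e ∈ E, σ e = τ e),
            ∑ x ∈ univ.filter (fun x : Fin (2 * m' + 1 + 1) → SpaceTimeIdx L M => x q = y),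
              klScaleWt L M β J' ((univ.image fun i => (x i, σ i)).image (latticeLegPos (2 * (2 * M)))) *
                ‖sectorisedKernel L M β (klAnisoFamily L M β μ K klE0 (d * k - 1)) (klTowerInput L M β U μ K d k) (2 * m' + 1 + 1) σ x‖ ≤
          B (m' + 1) Fc)
    {α : ℝ} (hα : 0 < α)
    (hrow : ∀ X, ∑ Y, ‖((sectorSubMatrix L M β (bgmFatMultiplier L M klE0 β (nambuXiCT L μ K) (d * k - 1))).transpose *
        hubbardCovSliceCT L M β μ 0 K (klScale klE0 (d * (k + 1))) (klScale klE0 (d * k)) *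
          sectorSubMatrix L M β (bgmFatMultiplier L M klE0 β (nambuXiCT L μ K) (d * k - 1))) X Y‖ *
        klScaleWt L M β J' {latticeLegPos (2 * (2 * M)) X, latticeLegPos (2 * (2 * M)) Y} ≤ α)
    (hcol : ∀ Y, ∑ X, ‖((sectorSubMatrix L M β (bgmFatMultiplier L M klE0 β (nambuXiCT L μ K) (d * k - 1))).transpose *
        hubbardCovSliceCT L M β μ 0 K (klScale klE0 (d * (k + 1))) (klScale klE0 (d * k)) *
          sectorSubMatrix L M β (bgmFatMultiplier L M klE0 β (nambuXiCT L μ K) (d * k - 1))) X Y‖ *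
        klScaleWt L M β J' {latticeLegPos (2 * (2 * M)) X, latticeLegPos (2 * (2 * M)) Y} ≤ α)
    {ρ : ℝ} (hρ : 0 < ρ)
    (hθ : Real.exp 1 * α * normV (SpaceTimeIdx L M × SectorLeg (sectorCount (d * k - 1))) κ ρ
      (fun m' => (27 : ℝ) ^ 0 * (imagTimeWeight β M * B m' 0)) / κ ^ 2 < 1)
    {cr cc : ℝ} (hcc0 : 0 ≤ cc)
    (hrow' : ∀ X'', ∑ X', ‖(sectorAnalysisMatrix L M β (klAnisoFamily L M β μ K klE0 J') *
        sectorSubMatrix L M β (bgmFatMultiplier L M klE0 β (nambuXiCT L μ K) (d * k - 1))) X'' X'‖ *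
        klScaleWt L M β J' {latticeLegPos (2 * (2 * M)) X'', latticeLegPos (2 * (2 * M)) X'} ≤ cr)
    (hcol' : ∀ X', ∑ X'', ‖(sectorAnalysisMatrix L M β (klAnisoFamily L M β μ K klE0 J') *
        sectorSubMatrix L M β (bgmFatMultiplier L M klE0 β (nambuXiCT L μ K) (d * k - 1))) X'' X'‖ *
        klScaleWt L M β J' {latticeLegPos (2 * (2 * M)) X'', latticeLegPos (2 * (2 * M)) X'} ≤ cc)
    {N₀ : ℕ} (hN₀ : 2 ≤ N₀) (q : ℕ) (i : Fin (2 * q + 1 + 1)) (σ' : Fin (2 * q + 1 + 1) → SectorLeg (sectorCount J'))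
    (y : SpaceTimeIdx L M) :
    imagTimeWeight β M ^ (2 * q + 1) *
        ∑ x' ∈ univ.filter (fun x' : Fin (2 * q + 1 + 1) → SpaceTimeIdx L M => x' i = y),
          klScaleWt L M β J' ((univ.image x').image (fun x : SpaceTimeIdx L M => (((((2 * (x.1 : ℕ) : ℕ)) : ZMod (2 * (2 * M)))), x.2))) *
            ‖sectorisedKernel L M β (klAnisoFamily L M β μ K klE0 J') (klTowerIncr L M β U μ K d k) (2 * q + 1 + 1) σ' x'‖ ≤
      imagTimeWeight β M ^ (2 * q + 1) *
        (cr * cc ^ (2 * q + 1) *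
          (∑ n ∈ Ico 2 N₀, (κ⁻¹ ^ (2 * q + 1 + 1) * κ⁻¹ ^ (2 * (n - 1)) * (α ^ (n - 1) * Real.exp n)) *
              ∑ δ ∈ (Fintype.piFinset fun _ : Fin n => range (Fintype.card (SpaceTimeIdx L M × SectorLeg (sectorCount (d * k - 1))) / 2 + 1)) with
                  2 * q + 1 + 1 + 2 * (n - 1) ≤ ∑ a, 2 * δ a,
                ∑ pf : ↥(univ.erase i) → Fin n,
                  ((∏ j, ((2 * δ (pf j) : ℕ) : ℝ)) / ((∑ a, 2 * δ a : ℕ) : ℝ) ^ (univ.erase i).card) *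
                    ∏ a, (Real.exp 3 * κ) ^ (2 * δ a) *
                      ((27 : ℝ) ^ (univ.filter fun j : ↥(univ.erase i) => pf j = a).card *
                        (imagTimeWeight β M * B (δ a) (univ.filter fun j : ↥(univ.erase i) => pf j = a).card)) +
            ρ⁻¹ ^ (2 * q + 1 + 1) * (Real.exp 1 * normV (SpaceTimeIdx L M × SectorLeg (sectorCount (d * k - 1))) κ ρ
                (fun m' => (27 : ℝ) ^ 0 * (imagTimeWeight β M * B m' 0))) *
              (Real.exp 1 * α * normV (SpaceTimeIdx L M × SectorLeg (sectorCount (d * k - 1))) κ ρ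
                  (fun m' => (27 : ℝ) ^ 0 * (imagTimeWeight β M * B m' 0)) / κ ^ 2) ^ (N₀ - 1) /
              (1 - Real.exp 1 * α * normV (SpaceTimeIdx L M × SectorLeg (sectorCount (d * k - 1))) κ ρ
                  (fun m' => (27 : ℝ) ^ 0 * (imagTimeWeight β M * B m' 0)) / κ ^ 2)) +
          cr * cc ^ (2 * q + 1) *
            ∑ m' ∈ range (Fintype.card (SpaceTimeIdx L M × SectorLeg (sectorCount (d * k - 1))) / 2 + 1), (if q + 1 < m' then
              ((((2 * (q + 1)).factorial : ℝ))⁻¹ *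
                  ((∏ j ∈ univ.filter (fun j : Fin (2 * (q + 1)) => j ∉ univ.erase i), (2 * m' - (j : ℕ)) : ℕ) : ℝ)) *
                ((2 * m' : ℕ) : ℝ) ^ (univ.erase i).card * κ ^ (2 * m' - 2 * (q + 1)) *
                  ((27 : ℝ) ^ (univ.erase i).card * (imagTimeWeight β M * B m' (univ.erase i).card)) else 0)) := by
  have hβ' : β ≠ 0 := hβ.ne'
  have hJ₁ : 1 ≤ d * k := le_trans hd (Nat.le_mul_of_pos_right d hk)
  have hJ : d * k ≤ d * (k + 1) := Nat.mul_le_mul_left d (Nat.le_succ k)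
  have hwt := isTreeWeight_klScaleWt L M hβ.le J'
  have hG : klTowerInput L M β U μ K d k ∈ evenPart ℂ (HubbardFieldIdx L M) := klEffectiveAction_mem_evenPart hβ' U μ K klE0 (d * k)
  have hG0 : constPart ℂ (klTowerInput L M β U μ K d k) = 0 := constPart_klEffectiveAction_eq_zero β U μ K klE0 (d * k) hZ
  have hε : 0 ≤ imagTimeWeight β M := imagTimeWeight_nonneg hβ.le M
  have hi : i ∉ (univ.erase i : Finset (Fin (2 * q + 1 + 1))) := fun h => (mem_erase.1 h).1 rfl
  -- the two doors at the block geometry, output legs `univ.erase i` prescribed to `σ′`, pin `(y, σ′ i)`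
  have h2 := blockStep_ordersGe2_wtFull_le (L := L) (M := M) hwt hβ μ K hJ₁ hJ hJ' (latticeLegPos (2 * (2 * M))) (latticeLegPos (2 * (2 * M)))
    (klTowerInput L M β U μ K d k) hG hG0 hκ hGB B hB0 hB hα hrow hcol hρ hθ hcc0 hrow' hcol' hN₀ i (univ.erase i) hi σ' (y, σ' i)
  have h1 := blockStep_firstOrder_wtFull_le (L := L) (M := M) hwt hβ μ K hJ₁ hJ hJ' (latticeLegPos (2 * (2 * M))) (latticeLegPos (2 * (2 * M)))
    (klTowerInput L M β U μ K d k) hG hκ.le hGB B hB0 hB hcc0 hrow' hcol' i (univ.erase i) hi σ' (y, σ' i)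
  -- relabel both door outputs to the carrier's single-tuple form
  rw [sum_filter_prescribedAll_eq_pinnedTuple] at h2 h1
  -- split the increment
  refine mul_le_mul_of_nonneg_left ?_ (pow_nonneg hε _)
  rw [klTowerIncr_eq_ordersGe2_add_firstOrder β U μ K d k hZ]
  refine le_trans (sum_le_sum fun x' _ => ?_) (le_trans (le_of_eq (sum_add_distrib (s := univ.filter
    (fun x' : Fin (2 * q + 1 + 1) → SpaceTimeIdx L M => x' i = y)))) (add_le_add h2 h1))
  rw [← mul_add, sectorisedKernel_add, Pi.add_apply, Pi.add_apply]
  exact mul_le_mul_of_nonneg_left (norm_add_le _ _) (zero_le_one.trans (one_le_klScaleWt L M β J' _))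

/-! ## §3 The law-side row of the carrier `klTowerBornWtFull` -/

/-- **THE WEIGHTED ALL-KNOWN BORN ARRAY OBEYS THE BLOCK-STEP BOUND** (the `hstep₂` row of cure (α′), model half, door form).  At the born family
`J′ = dk` (`1 ≤ d`, `1 ≤ k`, `Z^K_{Λ_{dk}} ≠ 0`) and under the block constants of `pinnedTupleWtSum_klTowerIncr_le` (weight rate `dk`), in every even
degree `2(q+1)`: `klTowerBornWtFull … d k (2(q+1)) ≤ ε^{2q+1}·(graded-prescribed RHS over landing profiles `Fin (2q+1) → Fin n` + the pin-free binomial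
majorant `((2q+2)!)⁻¹·(2m′)^{2q+2}·κ^{2m′−2q−2}·(27^{2q+1}·ε·B m′ (2q+1))`)` — the supremum row (`ciSup_le`) over `(i, σ′, y)`. -/
theorem klTowerBornWtFull_le_of_blockConsts {β : ℝ} (hβ : 0 < β) (U μ : ℝ) (K : TrigPolyC4v) {d k : ℕ} (hd : 1 ≤ d) (hk : 1 ≤ k)
    (hZ : hubbardEffPartitionFnCT L M β U μ 0 K (klScale klE0 (d * k)) ≠ 0)
    {κ : ℝ} (hκ : 0 < κ)
    (hGB : IsGramBoundedR ((sectorSubMatrix L M β (bgmFatMultiplier L M klE0 β (nambuXiCT L μ K) (d * k - 1))).transpose *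
      hubbardCovSliceCT L M β μ 0 K (klScale klE0 (d * (k + 1))) (klScale klE0 (d * k)) *
        sectorSubMatrix L M β (bgmFatMultiplier L M klE0 β (nambuXiCT L μ K) (d * k - 1))) κ)
    (B : ℕ → ℕ → ℝ) (hB0 : ∀ m' Fc, 0 ≤ B m' Fc)
    (hB : ∀ (m' Fc : ℕ) (E : Finset (Fin (2 * m' + 1 + 1))) (τ : Fin (2 * m' + 1 + 1) → SectorLeg (sectorCount (d * k - 1)))
      (q : Fin (2 * m' + 1 + 1)), q ∈ E → E.card = Fc + 1 → ∀ y : SpaceTimeIdx L M,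
        imagTimeWeight β M ^ (2 * m' + 1) *
          ∑ σ ∈ univ.filter (fun σ : Fin (2 * m' + 1 + 1) → SectorLeg (sectorCount (d * k - 1)) => ∀ e ∈ E, σ e = τ e),
            ∑ x ∈ univ.filter (fun x : Fin (2 * m' + 1 + 1) → SpaceTimeIdx L M => x q = y),
              klScaleWt L M β (d * k) ((univ.image fun i => (x i, σ i)).image (latticeLegPos (2 * (2 * M)))) *
                ‖sectorisedKernel L M β (klAnisoFamily L M β μ K klE0 (d * k - 1)) (klTowerInput L M β U μ K d k) (2 * m' + 1 + 1) σ x‖ ≤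
          B (m' + 1) Fc)
    {α : ℝ} (hα : 0 < α)
    (hrow : ∀ X, ∑ Y, ‖((sectorSubMatrix L M β (bgmFatMultiplier L M klE0 β (nambuXiCT L μ K) (d * k - 1))).transpose *
        hubbardCovSliceCT L M β μ 0 K (klScale klE0 (d * (k + 1))) (klScale klE0 (d * k)) *
          sectorSubMatrix L M β (bgmFatMultiplier L M klE0 β (nambuXiCT L μ K) (d * k - 1))) X Y‖ *
        klScaleWt L M β (d * k) {latticeLegPos (2 * (2 * M)) X, latticeLegPos (2 * (2 * M)) Y} ≤ α)
    (hcol : ∀ Y, ∑ X, ‖((sectorSubMatrix L M β (bgmFatMultiplier L M klE0 β (nambuXiCT L μ K) (d * k - 1))).transpose *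
        hubbardCovSliceCT L M β μ 0 K (klScale klE0 (d * (k + 1))) (klScale klE0 (d * k)) *
          sectorSubMatrix L M β (bgmFatMultiplier L M klE0 β (nambuXiCT L μ K) (d * k - 1))) X Y‖ *
        klScaleWt L M β (d * k) {latticeLegPos (2 * (2 * M)) X, latticeLegPos (2 * (2 * M)) Y} ≤ α)
    {ρ : ℝ} (hρ : 0 < ρ)
    (hθ : Real.exp 1 * α * normV (SpaceTimeIdx L M × SectorLeg (sectorCount (d * k - 1))) κ ρ
      (fun m' => (27 : ℝ) ^ 0 * (imagTimeWeight β M * B m' 0)) / κ ^ 2 < 1)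
    {cr cc : ℝ} (hcr0 : 0 ≤ cr) (hcc0 : 0 ≤ cc)
    (hrow' : ∀ X'', ∑ X', ‖(sectorAnalysisMatrix L M β (klAnisoFamily L M β μ K klE0 (d * k)) *
        sectorSubMatrix L M β (bgmFatMultiplier L M klE0 β (nambuXiCT L μ K) (d * k - 1))) X'' X'‖ *
        klScaleWt L M β (d * k) {latticeLegPos (2 * (2 * M)) X'', latticeLegPos (2 * (2 * M)) X'} ≤ cr)
    (hcol' : ∀ X', ∑ X'', ‖(sectorAnalysisMatrix L M β (klAnisoFamily L M β μ K klE0 (d * k)) *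
        sectorSubMatrix L M β (bgmFatMultiplier L M klE0 β (nambuXiCT L μ K) (d * k - 1))) X'' X'‖ *
        klScaleWt L M β (d * k) {latticeLegPos (2 * (2 * M)) X'', latticeLegPos (2 * (2 * M)) X'} ≤ cc)
    {N₀ : ℕ} (hN₀ : 2 ≤ N₀) (q : ℕ) :
    klTowerBornWtFull L M β U μ K d k (2 * (q + 1)) ≤
      imagTimeWeight β M ^ (2 * q + 1) *
        (cr * cc ^ (2 * q + 1) *
          (∑ n ∈ Ico 2 N₀, (κ⁻¹ ^ (2 * q + 1 + 1) * κ⁻¹ ^ (2 * (n - 1)) * (α ^ (n - 1) * Real.exp n)) *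
              ∑ δ ∈ (Fintype.piFinset fun _ : Fin n => range (Fintype.card (SpaceTimeIdx L M × SectorLeg (sectorCount (d * k - 1))) / 2 + 1)) with
                  2 * q + 1 + 1 + 2 * (n - 1) ≤ ∑ a, 2 * δ a,
                ∑ pf : Fin (2 * q + 1) → Fin n,
                  ((∏ j, ((2 * δ (pf j) : ℕ) : ℝ)) / ((∑ a, 2 * δ a : ℕ) : ℝ) ^ (2 * q + 1)) *
                    ∏ a, (Real.exp 3 * κ) ^ (2 * δ a) *
                      ((27 : ℝ) ^ (univ.filter fun j : Fin (2 * q + 1) => pf j = a).card *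
                        (imagTimeWeight β M * B (δ a) (univ.filter fun j : Fin (2 * q + 1) => pf j = a).card)) +
            ρ⁻¹ ^ (2 * q + 1 + 1) * (Real.exp 1 * normV (SpaceTimeIdx L M × SectorLeg (sectorCount (d * k - 1))) κ ρ
                (fun m' => (27 : ℝ) ^ 0 * (imagTimeWeight β M * B m' 0))) *
              (Real.exp 1 * α * normV (SpaceTimeIdx L M × SectorLeg (sectorCount (d * k - 1))) κ ρ
                  (fun m' => (27 : ℝ) ^ 0 * (imagTimeWeight β M * B m' 0)) / κ ^ 2) ^ (N₀ - 1) /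
              (1 - Real.exp 1 * α * normV (SpaceTimeIdx L M × SectorLeg (sectorCount (d * k - 1))) κ ρ
                  (fun m' => (27 : ℝ) ^ 0 * (imagTimeWeight β M * B m' 0)) / κ ^ 2)) +
          cr * cc ^ (2 * q + 1) *
            ∑ m' ∈ range (Fintype.card (SpaceTimeIdx L M × SectorLeg (sectorCount (d * k - 1))) / 2 + 1), (if q + 1 < m' then
              (((2 * (q + 1)).factorial : ℝ))⁻¹ * ((2 * m' : ℕ) : ℝ) ^ (2 * (q + 1)) * κ ^ (2 * m' - 2 * (q + 1)) *
                ((27 : ℝ) ^ (2 * q + 1) * (imagTimeWeight β M * B m' (2 * q + 1))) else 0)) := by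
  have hε : 0 ≤ imagTimeWeight β M := imagTimeWeight_nonneg hβ.le M
  haveI : NeZero (sectorCount (d * k)) := ⟨(sectorCount_pos _).ne'⟩
  haveI : Nonempty (Fin (2 * (q + 1)) × (Fin (2 * (q + 1)) → SectorLeg (sectorCount (d * k))) × SpaceTimeIdx L M) :=
    ⟨(⟨0, by omega⟩, fun _ => ((0, 0), 0), Classical.arbitrary _)⟩
  unfold klTowerBornWtFull
  refine ciSup_le fun t => ?_
  rw [show 2 * (q + 1) - 1 = 2 * q + 1 by omega]
  have hmain := pinnedTupleWtSum_klTowerIncr_le (L := L) (M := M) hβ U μ K hd hk le_rfl hZ hκ hGB B hB0 hB hα hrow hcol hρ hθ hcc0 hrow' hcol'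
    hN₀ q t.1 t.2.1 t.2.2
  refine hmain.trans (mul_le_mul_of_nonneg_left (add_le_add (mul_le_mul_of_nonneg_left (add_le_add
    (le_of_eq (sum_congr rfl fun n _ => congrArg _ (sum_congr rfl fun δ _ => ?_))) le_rfl) (by positivity))
    (mul_le_mul_of_nonneg_left (sum_le_sum fun m' _ => ?_) (by positivity))) (pow_nonneg hε _))
  · -- landing profiles over `univ.erase i` ↦ over `Fin (2q+1)`
    have hcard : (univ.erase t.1 : Finset (Fin (2 * q + 1 + 1))).card = 2 * q + 1 := by
      rw [card_erase_of_mem (mem_univ _), card_univ, Fintype.card_fin]; rfl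
    have hcardT : Fintype.card (univ.erase t.1 : Finset (Fin (2 * q + 1 + 1))) = 2 * q + 1 := by
      rw [Fintype.card_coe, hcard]
    obtain ⟨e⟩ : Nonempty (Fin (2 * q + 1) ≃ (univ.erase t.1 : Finset (Fin (2 * q + 1 + 1)))) :=
      ⟨(Fintype.equivFinOfCardEq hcardT).symm⟩
    have h := sum_landingProfiles_eq_of_equiv e (fun l => ((2 * δ l : ℕ) : ℝ)) ((∑ a, 2 * δ a : ℕ) : ℝ)
      (fun a c => (Real.exp 3 * κ) ^ (2 * δ a) * ((27 : ℝ) ^ c * (imagTimeWeight β M * B (δ a) c)))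
    rw [hcardT, Fintype.card_fin] at h
    rw [hcard]
    exact h
  · -- the first-order summand: `(2m′ − i) ≤ 2m′`, `|univ.erase i| = 2q+1`
    have hcard : (univ.erase t.1 : Finset (Fin (2 * q + 1 + 1))).card = 2 * q + 1 := by
      rw [card_erase_of_mem (mem_univ _), card_univ, Fintype.card_fin]; rfl
    split_ifs with hq
    · rw [hcard]
      have hfilt : (univ.filter fun j : Fin (2 * (q + 1)) => j ∉ (univ.erase t.1 : Finset (Fin (2 * q + 1 + 1)))) = {t.1} := by
        ext j
        simp only [mem_filter, mem_univ, true_and, mem_erase, ne_eq, not_and, not_true_eq_false, imp_false, not_not,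
          mem_singleton]
      rw [hfilt, prod_singleton]
      have hle : (((2 * m' - (t.1 : ℕ) : ℕ)) : ℝ) ≤ ((2 * m' : ℕ) : ℝ) := by exact_mod_cast Nat.sub_le _ _
      have h27 : 0 ≤ (27 : ℝ) ^ (2 * q + 1) * (imagTimeWeight β M * B m' (2 * q + 1)) := by
        have := hB0 m' (2 * q + 1); positivity
      calc (((2 * (q + 1)).factorial : ℝ))⁻¹ * (((2 * m' - (t.1 : ℕ) : ℕ)) : ℝ) * ((2 * m' : ℕ) : ℝ) ^ (2 * q + 1) *
              κ ^ (2 * m' - 2 * (q + 1)) * ((27 : ℝ) ^ (2 * q + 1) * (imagTimeWeight β M * B m' (2 * q + 1)))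
          ≤ (((2 * (q + 1)).factorial : ℝ))⁻¹ * ((2 * m' : ℕ) : ℝ) * ((2 * m' : ℕ) : ℝ) ^ (2 * q + 1) *
              κ ^ (2 * m' - 2 * (q + 1)) * ((27 : ℝ) ^ (2 * q + 1) * (imagTimeWeight β M * B m' (2 * q + 1))) := by
            gcongr
        _ = (((2 * (q + 1)).factorial : ℝ))⁻¹ * ((2 * m' : ℕ) : ℝ) ^ (2 * (q + 1)) * κ ^ (2 * m' - 2 * (q + 1)) *
              ((27 : ℝ) ^ (2 * q + 1) * (imagTimeWeight β M * B m' (2 * q + 1))) := by ring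
    · exact le_rfl

end Born

end Summit.HubbardSuperconductivity.HubbardSuperconductivity.Theorems.EngineV8

end
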